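import Summits.NavierStokesRegularity.OSWSelfSimilar.SheetNSLineTorusCascadeWiener
import HarnessLib

/-!
# Viscous CLM on the torus (`a = 0`, `σ = 2`): complex data are dominated by the nonnegative cascade of their moduli —
# `|c_k(t)| ≤ C_k(t)`, hence the Wiener-norm threshold `2ν` for EVERY mean-zero `B₀` datum

HONEST FRAMING (cell ns-blowup GROUP B «PROFILE SEARCH», zone Z3, row Z3-U addendum A-F2 of `HOME/profile/z3/CENSUS-Z3.md`;
human rulings D-0035/D-0074): **1-D MODEL (viscous Constantin–Lax–Majda equation `ω_t = ω Hω + ν ω_xx` on `𝕋 = ℝ/2πℤ`);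
ODE calculus on Fourier-coefficient families, kernel-checked; not Euler, not Navier–Stokes; «violates: none — MODEL».**

OBJECT. For a general real mean-zero datum the analytic-signal coefficients `c_k(t) ∈ ℂ` of `z = Hω − iω = Σ_{k≥1} c_k e^{ikx}`
obey the same lower-triangular cascade `ċ_k = ½ Σ_{i+j=k} c_i c_j − ν k² c_k` (`IsComplexCascade`). MAJORANT PRINCIPLE: if a
nonnegative cascade `C` (`IsNonnegCascade`, companion file) starts above the moduli, `|c_k(0)| ≤ C_k(0)`, then
**`|c_k(t)| ≤ C_k(t)` for all `k`, `t ≥ 0`** (`norm_le_majorant`; strong induction, the fencing theorem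
`image_norm_le_of_norm_deriv_right_le_deriv_boundary'` applied to `e^{νk²t} c_k` against `e^{νk²t} C_k + ε` on `[a, t]`,
`a ↓ 0`). Consequently (`norm_partialSum_le_of_wiener`) **every datum with `Σ_k |c_k(0)| = ‖ω₀‖_{B₀} ≤ W < 2ν` has
`Σ_{k≤K} |c_k(t)| ≤ (2νW/(2ν − W))·e^{−νt}` for all `K`, `t ≥ 0`** — the uniform, decaying Wiener bound behind global existence
(pen: `B₀` continuation [cite: AmbroseLushnikovSiegelSilantyev2024, §3]); print proves global existence for `‖ω₀‖_{B₀} < ν/4`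
[cite: SilantyevLushnikovSiegelAmbrose2025, Thm 2.2] (any `σ > 0`); the triangular structure gives `2ν` at `σ = 2`.
bears_on: LADDER-NS N5 / zone Z3 (row Z3-U) → N1 linear core. WHAT THIS IS NOT: not NS; no PDE object (the majorant `C` is
supplied by the user — e.g. the nonnegative cascade from the data `|c_k(0)| + η·[k = 1]`); not the threshold value.
-/

namespace Summit.NavierStokesRegularity.OSWSelfSimilar
namespace SheetNSLineTorusCascade

open Finset Real Set

/-- **The complex cascade**: coefficients `c_k(t) ∈ ℂ` of the analytic signal of a general real mean-zero solution,
`ċ_k = ½ Σ_{i+j=k} c_i c_j − ν k² c_k` on `t > 0`, continuous on `[0, ∞)`, `c_0 ≡ 0`. [new here — MODEL] -/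
structure IsComplexCascade (ν : ℝ) (c : ℕ → ℝ → ℂ) : Prop where
  /-- mode `0` vanishes identically (mean-zero class) -/
  zero : ∀ t, c 0 t = 0
  /-- every mode is continuous on `[0, ∞)` -/
  cont : ∀ k, ContinuousOn (c k) (Ici 0)
  /-- the cascade (C) for `t > 0` -/
  ode : ∀ k : ℕ, ∀ t : ℝ, 0 < t →
    HasDerivAt (c k) ((1 / 2 : ℂ) * (∑ p ∈ antidiagonal k, c p.1 t * c p.2 t) - (ν : ℂ) * ((k : ℕ) : ℂ) ^ 2 * c k t) t

variable {ν : ℝ} {c : ℕ → ℝ → ℂ} {C : ℕ → ℝ → ℝ}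

namespace IsComplexCascade

/-- The weighted complex mode `e^{νk²t} • c_k(t)` has derivative `e^{νk²t} • ½ Σ_{i+j=k} c_i c_j` (`t > 0`). -/
theorem hasDerivAt_weighted (hc : IsComplexCascade ν c) (k : ℕ) {t : ℝ} (ht : 0 < t) :
    HasDerivAt (fun s => exp (ν * (k : ℝ) ^ 2 * s) • c k s)
      (exp (ν * (k : ℝ) ^ 2 * t) • ((1 / 2 : ℂ) * ∑ p ∈ antidiagonal k, c p.1 t * c p.2 t)) t := by
  have h1 : HasDerivAt (fun s => exp (ν * (k : ℝ) ^ 2 * s)) (exp (ν * (k : ℝ) ^ 2 * t) * (ν * (k : ℝ) ^ 2)) t := by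
    have := ((hasDerivAt_id t).const_mul (ν * (k : ℝ) ^ 2)).exp
    simpa using this
  refine (h1.smul (hc.ode k t ht)).congr_deriv ?_
  simp only [Complex.real_smul]
  push_cast
  ring

/-- **MAJORANT PRINCIPLE.** If `C` is a nonnegative cascade with `|c_k(0)| ≤ C_k(0)` for all `k`, then `|c_k(t)| ≤ C_k(t)` for all
`k` and `t ≥ 0`. [new here — MODEL] -/
theorem norm_le_majorant (hc : IsComplexCascade ν c) (hC : IsNonnegCascade ν C) (h0 : ∀ k, ‖c k 0‖ ≤ C k 0) :
    ∀ k : ℕ, ∀ t : ℝ, 0 ≤ t → ‖c k t‖ ≤ C k t := by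
  intro k
  induction k using Nat.strong_induction_on with
  | _ k ih =>
    intro t ht
    rcases ht.eq_or_lt with h | htpos
    · rw [← h]; exact h0 k
    -- ψ = e^{νk²s} • c_k, Ψ = e^{νk²s} C_k
    set ψ : ℝ → ℂ := fun s => exp (ν * (k : ℝ) ^ 2 * s) • c k s with hψ
    set Ψ : ℝ → ℝ := fun s => exp (ν * (k : ℝ) ^ 2 * s) * C k s with hΨ
    set Ψ' : ℝ → ℝ := fun s => exp (ν * (k : ℝ) ^ 2 * s) * ((1 / 2) * ∑ p ∈ antidiagonal k, C p.1 s * C p.2 s) with hΨ'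
    have hψcont : ContinuousOn ψ (Ici 0) :=
      ((continuous_exp.comp (continuous_const.mul continuous_id)).continuousOn).smul (hc.cont k)
    have hΨcont : ContinuousOn Ψ (Ici 0) :=
      ((continuous_exp.comp (continuous_const.mul continuous_id)).continuousOn).mul (hC.cont k)
    -- the derivative bound ‖ψ'(x)‖ ≤ Ψ'(x) for x > 0
    have hbound : ∀ x, 0 < x →
        ‖exp (ν * (k : ℝ) ^ 2 * x) • ((1 / 2 : ℂ) * ∑ p ∈ antidiagonal k, c p.1 x * c p.2 x)‖ ≤ Ψ' x := by
      intro x hx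
      rw [norm_smul, norm_of_nonneg (exp_pos _).le, hΨ']
      refine mul_le_mul_of_nonneg_left ?_ (exp_pos _).le
      rw [norm_mul]
      have hhalf : ‖(1 / 2 : ℂ)‖ = 1 / 2 := by simp
      rw [hhalf]
      refine mul_le_mul_of_nonneg_left ?_ (by norm_num)
      refine le_trans (norm_sum_le _ _) (sum_le_sum fun p hp => ?_)
      rw [norm_mul]
      have hsum : p.1 + p.2 = k := mem_antidiagonal.mp hp
      rcases Nat.eq_zero_or_pos p.1 with h1 | h1
      · rw [h1, hc.zero, hC.zero]; simp
      rcases Nat.eq_zero_or_pos p.2 with h2 | h2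
      · rw [h2, hc.zero, hC.zero]; simp
      exact mul_le_mul (ih p.1 (by omega) x hx.le) (ih p.2 (by omega) x hx.le) (norm_nonneg _)
        (hC.nonneg p.1 x hx.le)
    -- ε-fencing on [a, t] with a ↓ 0
    have hmain : ‖ψ t‖ ≤ Ψ t := by
      refine le_of_forall_pos_le_add fun ε hε => ?_
      -- choose a ∈ (0, t) with ‖ψ a‖ ≤ Ψ a + ε
      have hψ0 : ContinuousWithinAt ψ (Ici 0) 0 := hψcont 0 self_mem_Ici
      have hΨ0 : ContinuousWithinAt Ψ (Ici 0) 0 := hΨcont 0 self_mem_Ici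
      rw [Metric.continuousWithinAt_iff] at hψ0 hΨ0
      obtain ⟨δ₁, hδ₁, h₁⟩ := hψ0 (ε / 2) (by linarith)
      obtain ⟨δ₂, hδ₂, h₂⟩ := hΨ0 (ε / 2) (by linarith)
      set a : ℝ := min (t / 2) (min (δ₁ / 2) (δ₂ / 2)) with ha
      have ha0 : 0 < a := by positivity
      have hat : a < t := by
        have : a ≤ t / 2 := min_le_left _ _
        linarith
      have haδ₁ : dist a 0 < δ₁ := by
        rw [dist_zero_right, norm_of_nonneg ha0.le]
        have : a ≤ δ₁ / 2 := le_trans (min_le_right _ _) (min_le_left _ _)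
        linarith
      have haδ₂ : dist a 0 < δ₂ := by
        rw [dist_zero_right, norm_of_nonneg ha0.le]
        have : a ≤ δ₂ / 2 := le_trans (min_le_right _ _) (min_le_right _ _)
        linarith
      have hd₁ := h₁ (x := a) ha0.le haδ₁
      have hd₂ := h₂ (x := a) ha0.le haδ₂
      rw [dist_eq_norm] at hd₁
      rw [Real.dist_eq] at hd₂
      have hstart : ‖ψ a‖ ≤ Ψ a + ε := by
        have e0 : ‖ψ 0‖ ≤ Ψ 0 := by
          simp only [hψ, hΨ, mul_zero, exp_zero, one_smul, one_mul]
          exact h0 k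
        have e1 : ‖ψ a‖ ≤ ‖ψ 0‖ + ε / 2 := by
          have := norm_le_norm_add_norm_sub' (ψ a) (ψ 0)
          have hcomm : ‖ψ a - ψ 0‖ < ε / 2 := hd₁
          linarith [norm_sub_rev (ψ 0) (ψ a)]
        have e2 : Ψ 0 ≤ Ψ a + ε / 2 := by
          have := abs_lt.mp hd₂
          linarith
        linarith
      -- fencing theorem on [a, t]
      have hfence := image_norm_le_of_norm_deriv_right_le_deriv_boundary'
        (f := ψ) (f' := fun x => exp (ν * (k : ℝ) ^ 2 * x) • ((1 / 2 : ℂ) * ∑ p ∈ antidiagonal k, c p.1 x * c p.2 x))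
        (a := a) (b := t) (hψcont.mono (fun x hx => le_trans ha0.le hx.1))
        (fun x hx => (hc.hasDerivAt_weighted k (lt_of_lt_of_le ha0 hx.1)).hasDerivWithinAt)
        (B := fun x => Ψ x + ε) (B' := Ψ') hstart
        ((hΨcont.mono (fun x hx => le_trans ha0.le hx.1)).add continuousOn_const)
        (fun x hx => ((hC.hasDerivAt_weighted k (lt_of_lt_of_le ha0 hx.1)).add_const ε).hasDerivWithinAt)
        (fun x hx => hbound x (lt_of_lt_of_le ha0 hx.1))
      exact hfence ⟨hat.le, le_rfl⟩
    -- unweight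
    have hE : 0 < exp (ν * (k : ℝ) ^ 2 * t) := exp_pos _
    have h1 : ‖ψ t‖ = exp (ν * (k : ℝ) ^ 2 * t) * ‖c k t‖ := by
      simp only [hψ, norm_smul, norm_of_nonneg hE.le]
    rw [h1] at hmain
    exact le_of_mul_le_mul_left (by simpa [hΨ] using hmain) hE

/-- **WIENER THRESHOLD `2ν` FOR GENERAL DATA (via the majorant).** If a nonnegative cascade `C` with `C_1(0) > 0` dominates the
data moduli, `|c_k(0)| ≤ C_k(0)`, and has total mass `Σ_{k≤K} C_k(0) ≤ W < 2ν` for every `K`, then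
`Σ_{k≤K} |c_k(t)| ≤ (2νW/(2ν − W))·e^{−νt}` for all `K`, `t ≥ 0`. [new here — MODEL] -/
theorem norm_partialSum_le_of_wiener (hc : IsComplexCascade ν c) (hC : IsNonnegCascade ν C) (hν : 0 < ν)
    (h0 : ∀ k, ‖c k 0‖ ≤ C k 0) (h1 : 0 < C 1 0) {W : ℝ} (hW : W < 2 * ν)
    (hdata : ∀ K, ∑ k ∈ range (K + 1), C k 0 ≤ W) (K : ℕ) (t : ℝ) (ht : 0 ≤ t) :
    ∑ k ∈ range (K + 1), ‖c k t‖ ≤ 2 * ν * W / (2 * ν - W) * exp (-(ν * t)) :=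
  le_trans (sum_le_sum fun k _ => hc.norm_le_majorant hC h0 k t ht) (hC.partialSum_le_of_wiener hν h1 hW hdata K t ht)

end IsComplexCascade

end SheetNSLineTorusCascade
end Summit.NavierStokesRegularity.OSWSelfSimilar
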